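import Mathlib.Analysis.SpecialFunctions.Pow.Real
import Mathlib.Analysis.SpecialFunctions.Log.Basic
import HarnessLib

/-!
# HANDOFF — the dodger ceiling's rate beats the twin-prime window for EVERY prime `q ≥ 3` once `|C| ≤ 7/100` (cell rh-explicit, TRACK «HANDOFF», seat theory-2 gen7, file XII-r)

HONEST FRAMING. Nothing here bears on the truth of RH; this is one real inequality. prove-2's `HandoffDodgerUpperClause.ceiling_rate_lt`
(p378691) shows `C·(log q)^{3/2}·q^{−3/2} < 1/(2(q+1))` — the dodger ceiling's scale is below half the shortest possible window
`(log(q+2) − log q)/2 > 1/(q+1)·…` — for `q > (256|C| + 1)⁴`, whence `upperClause_eventually_of_dodgerWallCeiling` with the threshold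
`max(q₀, ⌈(256|C|+1)⁴⌉ + 3)`. handoff-idea-2 gen24 (COMPARISON.md, 2026-08-24) observed that for the SMALL constants the route actually
produces (`C ≲ 0.02` ESTIMATE, `≤ 0.057` MODEL) the threshold is spurious: the inequality holds for every `q ≥ 3`. This file proves exactly
that, from `log x ≤ 3x^{1/3}` (`Real.log_le_rpow_div`): **`ceiling_rate_lt_of_abs_le : 3 ≤ q → |C| ≤ 7/100 → C·(log q)^{3/2}·q^{−3/2} < 1/(2(q+1))`**,
so that (in prove-2's successor's hands) the «eventually» of the dodger route is `{primes ≥ q₀}` with the witness family's own `q₀` and nothing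
else. (Sharp constant: the inequality holds for all `q ≥ 3` iff `|C| < min_q q^{3/2}/(2(q+1)(log q)^{3/2}) = 0.4075…` at `q = 13` — idea-2's
`m(13)`; `7/100` is what the one-line bound `(log q)^{3/2} ≤ 3^{3/2}√q` affords and covers the route's constants.)
References: this track (handoff-prove-2 ATTEMPT-15 §5–§6; handoff-idea-2 gen24 COMPARISON.md). Folklore real analysis.
-/

set_option linter.dupNamespace false  -- the mandated namespace repeats `RiemannHypothesis`

namespace Summit.RiemannHypothesis.RiemannHypothesis.Theorems.HandoffCeilingRateSmallC

/-- `3^{3/2} < 26/5` (`3^{3/2} = 3√3 = 5.196…`). [folklore] -/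
theorem three_rpow_three_halves_lt : (3 : ℝ) ^ (3 / 2 : ℝ) < 26 / 5 := by
  have h : (3 : ℝ) ^ (3 / 2 : ℝ) = 3 * Real.sqrt 3 := by
    rw [show (3 / 2 : ℝ) = 1 + 1 / 2 by norm_num, Real.rpow_add (by norm_num : (0 : ℝ) < 3), Real.rpow_one,
      Real.sqrt_eq_rpow]
  rw [h]
  have hs : Real.sqrt 3 < 26 / 15 := by
    rw [Real.sqrt_lt' (by norm_num)]
    norm_num
  linarith

/-- `(log x)^{3/2} ≤ 3^{3/2}·x^{1/2}` for `x ≥ 1` (from `log x ≤ 3x^{1/3}`). [folklore] -/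
theorem log_rpow_three_halves_le {x : ℝ} (hx : 1 ≤ x) :
    Real.log x ^ (3 / 2 : ℝ) ≤ (3 : ℝ) ^ (3 / 2 : ℝ) * x ^ (1 / 2 : ℝ) := by
  have hx0 : 0 ≤ x := by linarith
  have hlog0 : 0 ≤ Real.log x := Real.log_nonneg hx
  have h1 : Real.log x ≤ 3 * x ^ (1 / 3 : ℝ) := by
    have := Real.log_le_rpow_div hx0 (by norm_num : (0 : ℝ) < 1 / 3)
    linarith [this]
  have h2 : Real.log x ^ (3 / 2 : ℝ) ≤ (3 * x ^ (1 / 3 : ℝ)) ^ (3 / 2 : ℝ) :=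
    Real.rpow_le_rpow hlog0 h1 (by norm_num)
  have h3 : (3 * x ^ (1 / 3 : ℝ)) ^ (3 / 2 : ℝ) = (3 : ℝ) ^ (3 / 2 : ℝ) * x ^ (1 / 2 : ℝ) := by
    rw [Real.mul_rpow (by norm_num) (Real.rpow_nonneg hx0 _), ← Real.rpow_mul hx0]
    norm_num
  linarith [h2, h3.le, h3.ge]

/-- **The dodger ceiling's rate is inside every window from `q = 3` on, for `|C| ≤ 7/100`**:
`C·(log q)^{3/2}·q^{−3/2} < 1/(2(q+1))` for every natural `q ≥ 3` — the hypothesis `(256|C|+1)⁴ < q` of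
`HandoffDodgerUpperClause.ceiling_rate_lt` is unnecessary for such `C`. [this track] -/
theorem ceiling_rate_lt_of_abs_le {C : ℝ} {q : ℕ} (hq3 : 3 ≤ q) (hC : |C| ≤ 7 / 100) :
    C * Real.log q ^ (3 / 2 : ℝ) * (q : ℝ) ^ (-(3 / 2 : ℝ)) < 1 / (2 * ((q : ℝ) + 1)) := by
  have hx3 : (3 : ℝ) ≤ q := by exact_mod_cast hq3
  have hx0 : (0 : ℝ) < q := by linarith
  have hx1 : (1 : ℝ) ≤ q := by linarith
  have hlogpow0 : 0 ≤ Real.log (q : ℝ) ^ (3 / 2 : ℝ) := Real.rpow_nonneg (Real.log_nonneg hx1) _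
  have hneg0 : 0 ≤ (q : ℝ) ^ (-(3 / 2 : ℝ)) := Real.rpow_nonneg hx0.le _
  -- |C|·(log q)^{3/2}·q^{-3/2} ≤ (7/100)·(26/5)·q^{1/2}·q^{-3/2} = (7/100)(26/5)/q
  have hprod : Real.log (q : ℝ) ^ (3 / 2 : ℝ) * (q : ℝ) ^ (-(3 / 2 : ℝ)) ≤ 26 / 5 * (q : ℝ)⁻¹ := by
    have hA := log_rpow_three_halves_le hx1
    have hB : (q : ℝ) ^ (1 / 2 : ℝ) * (q : ℝ) ^ (-(3 / 2 : ℝ)) = (q : ℝ)⁻¹ := by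
      rw [← Real.rpow_add hx0, show (1 / 2 : ℝ) + -(3 / 2 : ℝ) = -1 by norm_num, Real.rpow_neg_one]
    calc Real.log (q : ℝ) ^ (3 / 2 : ℝ) * (q : ℝ) ^ (-(3 / 2 : ℝ))
        ≤ ((3 : ℝ) ^ (3 / 2 : ℝ) * (q : ℝ) ^ (1 / 2 : ℝ)) * (q : ℝ) ^ (-(3 / 2 : ℝ)) :=
          mul_le_mul_of_nonneg_right hA hneg0
      _ = (3 : ℝ) ^ (3 / 2 : ℝ) * (q : ℝ)⁻¹ := by rw [mul_assoc, hB]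
      _ ≤ 26 / 5 * (q : ℝ)⁻¹ := mul_le_mul_of_nonneg_right three_rpow_three_halves_lt.le (inv_nonneg.2 hx0.le)
  have habs : C * Real.log q ^ (3 / 2 : ℝ) * (q : ℝ) ^ (-(3 / 2 : ℝ)) ≤
      |C| * (Real.log q ^ (3 / 2 : ℝ) * (q : ℝ) ^ (-(3 / 2 : ℝ))) := by
    rw [mul_assoc]
    exact mul_le_mul_of_nonneg_right (le_abs_self C) (mul_nonneg hlogpow0 hneg0)
  have hfin : |C| * (26 / 5 * (q : ℝ)⁻¹) < 1 / (2 * ((q : ℝ) + 1)) := by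
    rw [← div_eq_mul_inv, mul_div_assoc', div_lt_div_iff₀ hx0 (by linarith)]
    nlinarith [abs_nonneg C]
  calc C * Real.log q ^ (3 / 2 : ℝ) * (q : ℝ) ^ (-(3 / 2 : ℝ))
      ≤ |C| * (Real.log q ^ (3 / 2 : ℝ) * (q : ℝ) ^ (-(3 / 2 : ℝ))) := habs
    _ ≤ |C| * (26 / 5 * (q : ℝ)⁻¹) := mul_le_mul_of_nonneg_left hprod (abs_nonneg C)
    _ < 1 / (2 * ((q : ℝ) + 1)) := hfin

/-- The same for the route's displayed constants: `C = 1/50` (prove-2's ESTIMATE `C ≲ 0.02`) and `C = 57/1000` (theory-1's worst-case MODEL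
factor `2.83·C`). [this track] -/
theorem ceiling_rate_lt_one_div_fifty {q : ℕ} (hq3 : 3 ≤ q) :
    (1 / 50 : ℝ) * Real.log q ^ (3 / 2 : ℝ) * (q : ℝ) ^ (-(3 / 2 : ℝ)) < 1 / (2 * ((q : ℝ) + 1)) :=
  ceiling_rate_lt_of_abs_le hq3 (by norm_num [abs_of_pos])

end Summit.RiemannHypothesis.RiemannHypothesis.Theorems.HandoffCeilingRateSmallC
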